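import Summits.BirchSwinnertonDyer.Rank1Residual.Supersingular.SprungPollackConsistency
import Summits.BirchSwinnertonDyer.Rank1Residual.X1.MuLambdaAlgebra
import Literature.NumberTheory.EllipticCurves.PlusMinusPAdicLFunctionProofs
import Mathlib.RingTheory.Polynomial.Eisenstein.IsIntegral
import HarnessLib

/-!
# Mazur–Tate elements modulo `p`: `u_n ≡ ±ω_n^+`, `v_n ≡ ±ω_n^-`, `ω_n ≡ T^{pⁿ}`, and THE READING
# `λ(θ_n) = deg ω_n^± + λ(L^•)` at the level of `Λ = ℤ_p⟦T⟧`
# (cell `b2b-bsdres`, supersingular family, prover B = unit `b2b-bsdres-additive-p3`, gen 4; part 1/2)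

HONEST FRAMING (run/shared/lean/b2b/bsd-rank1-residual/, verbatim in every file): the goal of the
cell is to DELETE the COMBINATION-SHAPED residual classes of the Birch–Swinnerton-Dyer formula for
ALL analytic-rank `≤ 1` elliptic curves over `ℚ` — "full BSD formula for every rank `≤ 1` curve in
class `C`" assembled STRICTLY from published theorems — so that the rank-`≤ 1` remainder becomes
exactly the CONSTRUCTION-SHAPED classes, which are TYPED (missing-input `Prop`s), NOT attempted.
This is not "finishing BSD". THEOREMS ONLY (pure algebra of `Λ = ℤ_p⟦T⟧` and `𝔽_p⟦T⟧`; the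
coefficient map `ℤ → ℤ_p → 𝔽_p` written out in full; no named fact; nothing about any curve
is asserted; nothing booked; labels unchanged).

## What this file proves, and why (part 1; part 2 = `MazurTateLambdaReading.lean`)

Every supersingular per-pair certificate of the cell (`KobayashiSqueezeReal`, `SignedSqueeze`,
`SharpFlatConverseReal`: "`μ(L^•) = 0`, `λ(L^•) = 1`") is displayed as a binder on the TREE OBJECT
`L^•` (Sprung's `L♯/L♭`, `Sprung2017.IsSprungPair`; at `a_p = 0` Pollack's `L^±`), while what the
census seats' two engines COMPUTE (iw-2 `tables/ss_support_X678.tsv`, IWASAWA-CENSUS §6.3; PARI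
`ellpadiclambdamu` and modular symbols) are the `μ`/`λ`-invariants of the MAZUR–TATE ELEMENTS `θ_n`.
The passage `λ(θ_n) ↦ λ(L^•)` was a paper formula (Perrin-Riou; Pollack, Duke Math. J. 118 (2003)
Prop. 6.9–6.10 for `a_p = 0`: "`λ(θ_n) = q_n + λ(L_p^±)`"; Sprung, Algebra Number Theory 11 (2017)
§3, the invariants `μ_±, λ_±` of a queue sequence, Cor. 3.6). These two files make it a KERNEL
THEOREM in the tree's labelling (`♯ ↔` odd levels `↔ ω_n^+`, `♭ ↔` even levels `↔ ω_n^-`, as in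
`isSprungPair_zero_iff`). Here:

* `map_residue_eq_X_pow_of_monic_of_dvd`, `map_residue_cyclotomicOmegaPlus/Minus/Omega` — the
  Eisenstein polynomials `Φ_{p^k}(1+T)` (Mathlib `cyclotomic_prime_pow_comp_X_add_one_isEisensteinAt`)
  and hence `ω_n^±`, `ω_n` reduce to the MONOMIALS `T^{deg}` in `𝔽_p[T]` (`deg ω_n = pⁿ`);
* `map_residue_sprungSeq_eq` — for `p ∣ a_p` the recursion polynomials reduce mod `p` to their
  `a_p = 0` values; with `sharpPoly_zero_of_odd/even`, `flatPoly_zero_of_even/odd` (p212724):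
  `u_n ≡ (−1)^{⌊n/2⌋} ω_n^+`, `v_n ≡ 0` (`n` odd), `v_n ≡ (−1)^{⌊n/2⌋} ω_n^-`, `u_n ≡ 0` (`n` even) mod `p`;
* **`mu_eq_zero_and_lam_add_eq_of_odd` / `_of_even` (THE READING)**: if `(L♯, L♭)` satisfies the
  level-`n` congruence integrally, `Θ := ω_n Q − (u_n L♯ + v_n L♭) ∈ Λ` (so `ι Θ = θ_n`), `Θ ≠ 0`,
  `μ(Θ) = 0` and `λ(Θ) < pⁿ`, then for `n` odd `μ(L♯) = 0` and `λ(L♯) + deg ω_n^+ = λ(Θ)`; for `n` even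
  the same with `♭`, `ω_n^-`. Proof in `𝔽_p⟦T⟧`: `Θ̄ = T^{pⁿ} Q̄ ∓ T^{deg ω_n^±} L̄^•`, and
  `ord_T Θ̄ < pⁿ` forces `L̄^• ≠ 0` and `ord_T Θ̄ = deg ω_n^± + ord_T L̄^•`.

References: [Sprung2017] §3 (the invariants `μ_±, λ_±`; Cor. 3.6), Cor. 4.4; [Pollack2003] Prop. 6.9,
6.10, Lemma 4.7 (`ω_n^±`, `q_n`), Thm. 6.17; [GreenbergVatsal2000] (1)–(2); L. Washington, GTM 83, §7.1.
Memo: `HOME/b2b-bsdres-additive-p3/X8-ROUTE-B.md` §9 (gen 4).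
-/

set_option autoImplicit false

noncomputable section

open scoped Classical MatrixGroups ModularForm

open CongruenceSubgroup Polynomial WeierstrassCurve Literature.NumberTheory.EllipticCurves
  Literature.NumberTheory.EllipticCurves.ModularForms
  Literature.NumberTheory.EllipticCurves.Sprung2017
  Summit.BirchSwinnertonDyer.Rank1Residual.X1.MuLambda

namespace Summit.BirchSwinnertonDyer.Rank1Residual.Supersingular

/-! ## §1. Reduction modulo `p` of polynomials pushed into `Λ` -/

section Reduction

variable {p : ℕ} [hp : Fact p.Prime]

-- The coefficient reduction `ℤ → ℤ_p → 𝔽_p` used by `red ∘ toIwasawa` is written out in full below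
-- as `(IsLocalRing.residue ℤ_[p]).comp (Int.castRingHom ℤ_[p])` (no definition, no notation).

/-- `red (toIwasawa q) = ↑(q.map (residue ∘ Int.cast))`: reducing the pushed-forward polynomial
coefficientwise. [folklore] -/
theorem red_toIwasawa (q : ℤ[X]) :
    red (toIwasawa p q) =
      ((q.map ((IsLocalRing.residue ℤ_[p]).comp (Int.castRingHom ℤ_[p])) :
          (IsLocalRing.ResidueField ℤ_[p])[X]) : PowerSeries (IsLocalRing.ResidueField ℤ_[p])) := by
  ext i
  rw [red, toIwasawa_apply, PowerSeries.coeff_map, Polynomial.coeff_coe, Polynomial.coeff_coe,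
    Polynomial.coeff_map, Polynomial.coeff_map]
  rfl

/-- `red` is multiplicative (it is the ring map `PowerSeries.map residue`). [folklore] -/
private theorem red_mul' (a b : IwasawaAlgebra p) : red (a * b) = red a * red b := map_mul _ a b

/-- `red` is additive. [folklore] -/
private theorem red_add' (a b : IwasawaAlgebra p) : red (a + b) = red a + red b := map_add _ a b

/-- `red` respects subtraction. [folklore] -/
private theorem red_sub' (a b : IwasawaAlgebra p) : red (a - b) = red a - red b := map_sub _ a b

/-- `p ↦ 0` in `𝔽_p`. [folklore] -/
theorem intResidue_natCast_self :
    ((IsLocalRing.residue ℤ_[p]).comp (Int.castRingHom ℤ_[p])) (p : ℤ) = 0 := by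
  rw [RingHom.comp_apply, map_natCast, IsLocalRing.residue_eq_zero_iff,
    PadicInt.maximalIdeal_eq_span_p]
  exact Ideal.mem_span_singleton_self _

/-- If `p` divides an integer then its residue in `𝔽_p` vanishes. [folklore] -/
theorem intResidue_eq_zero_of_dvd {c : ℤ} (h : (p : ℤ) ∣ c) :
    ((IsLocalRing.residue ℤ_[p]).comp (Int.castRingHom ℤ_[p])) c = 0 := by
  obtain ⟨d, rfl⟩ := h
  rw [map_mul, intResidue_natCast_self, zero_mul]

/-- **A monic "Eisenstein-shaped" polynomial reduces to the monomial `T^{deg}`**: if `q ∈ ℤ[T]` is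
monic and `p` divides every coefficient below the leading one, then `q ↦ T^{deg q}` in `𝔽_p[T]`.
[folklore] -/
theorem map_residue_eq_X_pow_of_monic_of_dvd {q : ℤ[X]} (hmon : q.Monic)
    (hdvd : ∀ i < q.natDegree, (p : ℤ) ∣ q.coeff i) :
    q.map ((IsLocalRing.residue ℤ_[p]).comp (Int.castRingHom ℤ_[p])) = X ^ q.natDegree := by
  ext i
  rw [Polynomial.coeff_map, Polynomial.coeff_X_pow]
  rcases lt_trichotomy i q.natDegree with hlt | heq | hgt
  · rw [if_neg hlt.ne, intResidue_eq_zero_of_dvd (hdvd i hlt)]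
  · subst heq
    rw [if_pos rfl, ← Polynomial.leadingCoeff, hmon.leadingCoeff, map_one]
  · rw [if_neg hgt.ne', Polynomial.coeff_eq_zero_of_natDegree_lt hgt, map_zero]

/-- `Φ_{p^{k+1}}(1+T) ↦ T^{deg}` in `𝔽_p[T]` (Eisenstein at `p`: Mathlib
`cyclotomic_prime_pow_comp_X_add_one_isEisensteinAt`). [folklore] -/
theorem map_residue_cyclotomic_comp (k : ℕ) :
    ((cyclotomic (p ^ (k + 1)) ℤ).comp (X + 1)).map
        ((IsLocalRing.residue ℤ_[p]).comp (Int.castRingHom ℤ_[p])) =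
      X ^ ((cyclotomic (p ^ (k + 1)) ℤ).comp (X + 1)).natDegree := by
  refine map_residue_eq_X_pow_of_monic_of_dvd (monic_cyclotomic_comp_X_add_one _) fun i hi ↦ ?_
  have h := (cyclotomic_prime_pow_comp_X_add_one_isEisensteinAt p k).mem hi
  exact Ideal.mem_span_singleton.mp h

/-- A product of the `Φ_{p^{j}}(1+T)`, `j ≥ 1`, reduces to `T^{deg}`. [folklore] -/
theorem map_residue_prod_cyclotomic_comp (s : Finset ℕ) (e : ℕ → ℕ) :
    (∏ k ∈ s, (cyclotomic (p ^ (e k + 1)) ℤ).comp (X + 1)).map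
        ((IsLocalRing.residue ℤ_[p]).comp (Int.castRingHom ℤ_[p])) =
      X ^ (∏ k ∈ s, (cyclotomic (p ^ (e k + 1)) ℤ).comp (X + 1)).natDegree := by
  rw [Polynomial.map_prod, Polynomial.natDegree_prod_of_monic _ _
    (fun k _ ↦ monic_cyclotomic_comp_X_add_one _), ← Finset.prod_pow_eq_pow_sum]
  exact Finset.prod_congr rfl fun k _ ↦ map_residue_cyclotomic_comp (p := p) (e k)

/-- **`ω_n^+ ↦ T^{deg ω_n^+}` in `𝔽_p[T]`.** [cite: Pollack2003, Lemma 4.7 and §6.5 (`ω_n^±`, `q_n`)] -/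
theorem map_residue_cyclotomicOmegaPlus (n : ℕ) :
    (cyclotomicOmegaPlus p n).map ((IsLocalRing.residue ℤ_[p]).comp (Int.castRingHom ℤ_[p])) =
      X ^ (cyclotomicOmegaPlus p n).natDegree := by
  have h : cyclotomicOmegaPlus p n =
      ∏ k ∈ Finset.Icc 1 (n / 2), (cyclotomic (p ^ ((2 * k - 1) + 1)) ℤ).comp (X + 1) := by
    rw [cyclotomicOmegaPlus]
    refine Finset.prod_congr rfl fun k hk ↦ ?_
    rw [show 2 * k - 1 + 1 = 2 * k from by have := (Finset.mem_Icc.mp hk).1; omega]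
  rw [h, map_residue_prod_cyclotomic_comp]

/-- **`ω_n^- ↦ T^{deg ω_n^-}` in `𝔽_p[T]`.** [cite: Pollack2003, Lemma 4.7 and §6.5 (`ω_n^±`, `q_n`)] -/
theorem map_residue_cyclotomicOmegaMinus (n : ℕ) :
    (cyclotomicOmegaMinus p n).map ((IsLocalRing.residue ℤ_[p]).comp (Int.castRingHom ℤ_[p])) =
      X ^ (cyclotomicOmegaMinus p n).natDegree := by
  have h : cyclotomicOmegaMinus p n =
      ∏ k ∈ Finset.Icc 1 ((n + 1) / 2), (cyclotomic (p ^ ((2 * k - 2) + 1)) ℤ).comp (X + 1) := by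
    rw [cyclotomicOmegaMinus]
    refine Finset.prod_congr rfl fun k hk ↦ ?_
    rw [show 2 * k - 2 + 1 = 2 * k - 1 from by have := (Finset.mem_Icc.mp hk).1; omega]
  rw [h, map_residue_prod_cyclotomic_comp]

/-- `deg ω_n = 1 + deg ω_n^+ + deg ω_n^- = pⁿ`. [cite: Pollack2003, §6.5 (`T ω_n^+ ω_n^- = ω_n`)] -/
theorem natDegree_cyclotomicOmegaPlus_add (n : ℕ) :
    1 + (cyclotomicOmegaPlus p n).natDegree + (cyclotomicOmegaMinus p n).natDegree = p ^ n := by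
  have h := congrArg Polynomial.natDegree (X_mul_cyclotomicOmegaPlus_mul_cyclotomicOmegaMinus p n)
  rw [Polynomial.Monic.natDegree_mul (monic_X.mul (monic_cyclotomicOmegaPlus p n))
      (monic_cyclotomicOmegaMinus p n),
    Polynomial.Monic.natDegree_mul monic_X (monic_cyclotomicOmegaPlus p n), natDegree_X] at h
  rw [h, cyclotomicOmega]
  have h1 : ((X + 1 : ℤ[X]) ^ p ^ n).natDegree = p ^ n := by
    rw [← C_1, Polynomial.natDegree_pow_X_add_C]
  rw [Polynomial.natDegree_sub_eq_left_of_natDegree_lt] <;> rw [h1]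
  simp [hp.out.pos]

/-- **`ω_n ↦ T^{pⁿ}` in `𝔽_p[T]`** (`(1+T)^{pⁿ} − 1 ≡ T^{pⁿ}`). [cite: Pollack2003, Thm. 6.17 (`ω_n`)] -/
theorem map_residue_cyclotomicOmega (n : ℕ) :
    (cyclotomicOmega p n).map ((IsLocalRing.residue ℤ_[p]).comp (Int.castRingHom ℤ_[p])) =
      X ^ (p ^ n) := by
  rw [← X_mul_cyclotomicOmegaPlus_mul_cyclotomicOmegaMinus, Polynomial.map_mul, Polynomial.map_mul,
    Polynomial.map_X, map_residue_cyclotomicOmegaPlus, map_residue_cyclotomicOmegaMinus, ← pow_succ',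
    ← pow_add, ← natDegree_cyclotomicOmegaPlus_add (p := p) n]
  ring_nf

/-- `red(ω_n) = T^{pⁿ}` in `𝔽_p⟦T⟧`. [cite: Pollack2003, Thm. 6.17 (`ω_n`)] -/
theorem red_toIwasawa_cyclotomicOmega (n : ℕ) :
    red (toIwasawa p (cyclotomicOmega p n)) =
      (PowerSeries.X : PowerSeries (IsLocalRing.ResidueField ℤ_[p])) ^ (p ^ n) := by
  rw [red_toIwasawa, map_residue_cyclotomicOmega, Polynomial.coe_pow, Polynomial.coe_X]

/-- **For `p ∣ a_p` the recursion polynomials reduce mod `p` to their `a_p = 0` values**: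
`x_n(a_p) ≡ x_n(0) (mod p)` coefficientwise. [cite: Sprung2017, §3.1 and Cor. 4.4] -/
theorem map_residue_sprungSeq_eq {ap : ℤ} (hap : (p : ℤ) ∣ ap) (x₀ x₁ : ℤ[X]) (n : ℕ) :
    (sprungSeq ap p x₀ x₁ n).map ((IsLocalRing.residue ℤ_[p]).comp (Int.castRingHom ℤ_[p])) =
      (sprungSeq 0 p x₀ x₁ n).map ((IsLocalRing.residue ℤ_[p]).comp (Int.castRingHom ℤ_[p])) := by
  induction n using Nat.strong_induction_on with
  | _ n ih =>
    match n with
    | 0 => rfl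
    | 1 => rfl
    | n + 2 =>
      rw [sprungSeq_add_two, sprungSeq_add_two]
      simp only [Polynomial.map_sub, Polynomial.map_mul, Polynomial.map_C, Polynomial.map_zero,
        intResidue_eq_zero_of_dvd hap, map_zero, zero_mul, ih n (by omega)]

/-- `u_n ≡ (−1)^{⌊n/2⌋} ω_n^+ (mod p)` for odd `n`, when `p ∣ a_p`: in `𝔽_p⟦T⟧`,
`red(u_n) = (−1)^{⌊n/2⌋} T^{deg ω_n^+}`. [cite: Sprung2017, §3.1 and Cor. 4.4] [cite: Pollack2003, §6.5] -/
theorem red_toIwasawa_sharpPoly_of_odd {ap : ℤ} (hap : (p : ℤ) ∣ ap) {n : ℕ} (hn : Odd n) :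
    red (toIwasawa p (sharpPoly ap p n)) =
      (-1) ^ (n / 2) * (PowerSeries.X : PowerSeries (IsLocalRing.ResidueField ℤ_[p])) ^
        (cyclotomicOmegaPlus p n).natDegree := by
  rw [red_toIwasawa, sharpPoly, map_residue_sprungSeq_eq hap, ← sharpPoly, sharpPoly_zero_of_odd p hn,
    Polynomial.map_mul, Polynomial.map_pow, Polynomial.map_neg, Polynomial.map_one,
    map_residue_cyclotomicOmegaPlus, Polynomial.coe_mul, Polynomial.coe_pow, Polynomial.coe_pow,
    Polynomial.coe_neg, Polynomial.coe_one, Polynomial.coe_X]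

/-- `u_n ≡ 0 (mod p)` for even `n`, when `p ∣ a_p`. [cite: Sprung2017, §3.1 and Cor. 4.4] -/
theorem red_toIwasawa_sharpPoly_of_even {ap : ℤ} (hap : (p : ℤ) ∣ ap) {n : ℕ} (hn : Even n) :
    red (toIwasawa p (sharpPoly ap p n)) = 0 := by
  rw [red_toIwasawa, sharpPoly, map_residue_sprungSeq_eq hap, ← sharpPoly, sharpPoly_zero_of_even p hn,
    Polynomial.map_zero, Polynomial.coe_zero]

/-- `v_n ≡ (−1)^{⌊n/2⌋} ω_n^- (mod p)` for even `n`, when `p ∣ a_p`. [cite: Sprung2017, §3.1 and Cor. 4.4] [cite: Pollack2003, §6.5] -/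
theorem red_toIwasawa_flatPoly_of_even {ap : ℤ} (hap : (p : ℤ) ∣ ap) {n : ℕ} (hn : Even n) :
    red (toIwasawa p (flatPoly ap p n)) =
      (-1) ^ (n / 2) * (PowerSeries.X : PowerSeries (IsLocalRing.ResidueField ℤ_[p])) ^
        (cyclotomicOmegaMinus p n).natDegree := by
  rw [red_toIwasawa, flatPoly, map_residue_sprungSeq_eq hap, ← flatPoly, flatPoly_zero_of_even p hn,
    Polynomial.map_mul, Polynomial.map_pow, Polynomial.map_neg, Polynomial.map_one,
    map_residue_cyclotomicOmegaMinus, Polynomial.coe_mul, Polynomial.coe_pow, Polynomial.coe_pow,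
    Polynomial.coe_neg, Polynomial.coe_one, Polynomial.coe_X]

/-- `v_n ≡ 0 (mod p)` for odd `n`, when `p ∣ a_p`. [cite: Sprung2017, §3.1 and Cor. 4.4] -/
theorem red_toIwasawa_flatPoly_of_odd {ap : ℤ} (hap : (p : ℤ) ∣ ap) {n : ℕ} (hn : Odd n) :
    red (toIwasawa p (flatPoly ap p n)) = 0 := by
  rw [red_toIwasawa, flatPoly, map_residue_sprungSeq_eq hap, ← flatPoly, flatPoly_zero_of_odd p hn,
    Polynomial.map_zero, Polynomial.coe_zero]

end Reduction

/-! ## §2. `μ`, `λ` and the reduction `red` -/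

section MuLambdaRed

variable {p : ℕ} [hp : Fact p.Prime]

/-- If `red g ≠ 0` then `μ(g) = 0` and `λ(g) = ord_T(red g)`. [cite: GreenbergVatsal2000, p. 2–3, (1)–(2)] -/
theorem mu_eq_zero_and_lam_eq_of_red_ne_zero {g : IwasawaAlgebra p} (h : red g ≠ 0) :
    mu g = 0 ∧ (lam g : ℕ∞) = (red g).order := by
  obtain ⟨hmu, hpf⟩ := mu_eq_and_pfree_eq h (show g = PowerSeries.C ((p : ℤ_[p]) ^ 0) * g by simp)
  refine ⟨hmu, ?_⟩
  rw [lam, hpf]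
  exact ENat.coe_toNat ((PowerSeries.order_finite_iff_ne_zero.mpr h).ne)

/-- If `g ≠ 0` and `μ(g) = 0` then `red g ≠ 0`. [cite: GreenbergVatsal2000, p. 2–3, (1)–(2)] -/
theorem red_ne_zero_of_mu_eq_zero {g : IwasawaAlgebra p} (hg : g ≠ 0) (hmu : mu g = 0) :
    red g ≠ 0 := by
  have hpf : pfree g = g := by
    have h := eq_C_pow_mu_mul_pfree g
    rw [hmu, pow_zero, map_one, one_mul] at h
    exact h.symm
  rw [← hpf]
  exact red_pfree_ne_zero hg

end MuLambdaRed

/-! ## §3. The reading in `𝔽_p⟦T⟧` and in `Λ` -/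

section Reading

variable {p : ℕ} [hp : Fact p.Prime]

/-- **Valuation bookkeeping in `k⟦T⟧` (`k` a field).** If `Θ̄ = T^M·Q̄ + U·Ā` with `U ≠ 0`, and
`ord_T Θ̄ < M` (so `Θ̄ ≠ 0`), then `Ā ≠ 0` and `ord_T Θ̄ = ord_T U + ord_T Ā`. [folklore] -/
theorem order_eq_of_eq_X_pow_mul_add {k : Type*} [Field k] {Θ Q U A : PowerSeries k} {M : ℕ}
    (hΘ : Θ = PowerSeries.X ^ M * Q + U * A) (hlt : Θ.order < M) :
    A ≠ 0 ∧ Θ.order = U.order + A.order := by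
  have hXQ : (M : ℕ∞) ≤ (PowerSeries.X ^ M * Q).order := by
    rw [PowerSeries.order_mul, PowerSeries.order_X_pow]
    exact le_self_add
  have hA : A ≠ 0 := by
    rintro rfl
    rw [mul_zero, add_zero] at hΘ
    rw [hΘ] at hlt
    exact absurd (lt_of_le_of_lt hXQ hlt) (lt_irrefl _)
  refine ⟨hA, ?_⟩
  have hUA : (U * A).order = U.order + A.order := PowerSeries.order_mul U A
  -- `ord(U A) < M`: otherwise both summands have order `≥ M`
  have hUAlt : (U * A).order < M := by
    by_contra hge
    rw [not_lt] at hge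
    have hmin := PowerSeries.min_order_le_order_add (PowerSeries.X ^ M * Q) (U * A)
    rw [← hΘ] at hmin
    exact absurd (lt_of_le_of_lt (le_trans (le_min hXQ hge) hmin) hlt) (lt_irrefl _)
  have hne : (PowerSeries.X ^ M * Q).order ≠ (U * A).order :=
    (ne_of_lt (lt_of_lt_of_le hUAlt hXQ)).symm
  rw [hΘ, PowerSeries.order_add_of_order_ne _ _ hne, min_eq_right (le_trans hUAlt.le hXQ), hUA]

/-- `ord_T (c · T^d) = d` for a non-zero constant `c`. [folklore] -/
private theorem order_C_mul_X_pow {k : Type*} [Field k] {c : k} (hc : c ≠ 0) (d : ℕ) :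
    (PowerSeries.C c * PowerSeries.X ^ d).order = (d : ℕ∞) := by
  rw [PowerSeries.order_mul, PowerSeries.order_X_pow, ← PowerSeries.monomial_zero_eq_C_apply,
    PowerSeries.order_monomial_of_ne_zero 0 c hc]
  simp

/-- **THE READING, odd level (`♯`).** Let `p ∣ a_p`, `n` odd, and `(L♯, L♭) ∈ Λ²` satisfy the
level-`n` congruence integrally: `Θ = ω_n·Q − (u_n L♯ + v_n L♭)` (the Mazur–Tate element `θ_n` as an
element of `Λ`). If `Θ ≠ 0`, `μ(Θ) = 0` and `λ(Θ) < pⁿ`, then `μ(L♯) = 0` and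
`λ(L♯) + deg ω_n^+ = λ(Θ)` — Pollack's "`λ(θ_n) = q_n + λ(L_p^+)`" for `n` odd / Sprung's `λ_♯`
read off the queue sequence, in the tree's labelling (`♯ ↔` odd levels).
[cite: Pollack2003, Prop. 6.9 and Prop. 6.10] [cite: Sprung2017, §3 (the invariants μ_±, λ_±) and Cor. 3.6] -/
theorem mu_eq_zero_and_lam_add_eq_of_odd {ap : ℤ} (hap : (p : ℤ) ∣ ap) {n : ℕ} (hn : Odd n)
    {A B Q Θ : IwasawaAlgebra p}
    (hΘ : Θ = toIwasawa p (cyclotomicOmega p n) * Q -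
      (toIwasawa p (sharpPoly ap p n) * A + toIwasawa p (flatPoly ap p n) * B))
    (hΘ0 : Θ ≠ 0) (hμ : mu Θ = 0) (hlt : lam Θ < p ^ n) :
    mu A = 0 ∧ lam A + (cyclotomicOmegaPlus p n).natDegree = lam Θ := by
  have hredΘ : red Θ ≠ 0 := red_ne_zero_of_mu_eq_zero hΘ0 hμ
  obtain ⟨-, hlamΘ⟩ := mu_eq_zero_and_lam_eq_of_red_ne_zero hredΘ
  have hc : (-(-1 : IsLocalRing.ResidueField ℤ_[p]) ^ (n / 2)) ≠ 0 :=
    neg_ne_zero.mpr (pow_ne_zero _ (neg_ne_zero.mpr one_ne_zero))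
  set U : PowerSeries (IsLocalRing.ResidueField ℤ_[p]) :=
    PowerSeries.C (-(-1 : IsLocalRing.ResidueField ℤ_[p]) ^ (n / 2)) *
      PowerSeries.X ^ (cyclotomicOmegaPlus p n).natDegree with hU_def
  have hred : red Θ = PowerSeries.X ^ (p ^ n) * red Q + U * red A := by
    rw [hΘ, red_sub', red_mul', red_add', red_mul', red_mul', red_toIwasawa_cyclotomicOmega,
      red_toIwasawa_sharpPoly_of_odd hap hn, red_toIwasawa_flatPoly_of_odd hap hn, zero_mul, add_zero,
      hU_def, map_neg, map_pow, map_neg, map_one]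
    ring
  have hUord : U.order = (cyclotomicOmegaPlus p n).natDegree := order_C_mul_X_pow hc _
  have hltM : (red Θ).order < (p ^ n : ℕ) := by
    rw [← hlamΘ]
    exact_mod_cast hlt
  obtain ⟨hA, hord⟩ := order_eq_of_eq_X_pow_mul_add hred hltM
  obtain ⟨hμA, hlamA⟩ := mu_eq_zero_and_lam_eq_of_red_ne_zero hA
  refine ⟨hμA, ?_⟩
  have h : (lam Θ : ℕ∞) = ((lam A + (cyclotomicOmegaPlus p n).natDegree : ℕ) : ℕ∞) := by
    rw [hlamΘ, hord, hUord, ← hlamA, Nat.cast_add, add_comm]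
  exact (Nat.cast_injective (R := ℕ∞) h).symm

/-- **THE READING, even level (`♭`)**: same with `n` even, `L♭` and `ω_n^-` — Pollack's
"`λ(θ_n) = q_n + λ(L_p^-)`" for `n` even / Sprung's `λ_♭`. [cite: Pollack2003, Prop. 6.9 and Prop. 6.10]
[cite: Sprung2017, §3 (the invariants μ_±, λ_±) and Cor. 3.6] -/
theorem mu_eq_zero_and_lam_add_eq_of_even {ap : ℤ} (hap : (p : ℤ) ∣ ap) {n : ℕ} (hn : Even n)
    {A B Q Θ : IwasawaAlgebra p}
    (hΘ : Θ = toIwasawa p (cyclotomicOmega p n) * Q -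
      (toIwasawa p (sharpPoly ap p n) * A + toIwasawa p (flatPoly ap p n) * B))
    (hΘ0 : Θ ≠ 0) (hμ : mu Θ = 0) (hlt : lam Θ < p ^ n) :
    mu B = 0 ∧ lam B + (cyclotomicOmegaMinus p n).natDegree = lam Θ := by
  have hredΘ : red Θ ≠ 0 := red_ne_zero_of_mu_eq_zero hΘ0 hμ
  obtain ⟨-, hlamΘ⟩ := mu_eq_zero_and_lam_eq_of_red_ne_zero hredΘ
  have hc : (-(-1 : IsLocalRing.ResidueField ℤ_[p]) ^ (n / 2)) ≠ 0 :=
    neg_ne_zero.mpr (pow_ne_zero _ (neg_ne_zero.mpr one_ne_zero))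
  set U : PowerSeries (IsLocalRing.ResidueField ℤ_[p]) :=
    PowerSeries.C (-(-1 : IsLocalRing.ResidueField ℤ_[p]) ^ (n / 2)) *
      PowerSeries.X ^ (cyclotomicOmegaMinus p n).natDegree with hU_def
  have hred : red Θ = PowerSeries.X ^ (p ^ n) * red Q + U * red B := by
    rw [hΘ, red_sub', red_mul', red_add', red_mul', red_mul', red_toIwasawa_cyclotomicOmega,
      red_toIwasawa_sharpPoly_of_even hap hn, red_toIwasawa_flatPoly_of_even hap hn, zero_mul, zero_add,
      hU_def, map_neg, map_pow, map_neg, map_one]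
    ring
  have hUord : U.order = (cyclotomicOmegaMinus p n).natDegree := order_C_mul_X_pow hc _
  have hltM : (red Θ).order < (p ^ n : ℕ) := by
    rw [← hlamΘ]
    exact_mod_cast hlt
  obtain ⟨hB, hord⟩ := order_eq_of_eq_X_pow_mul_add hred hltM
  obtain ⟨hμB, hlamB⟩ := mu_eq_zero_and_lam_eq_of_red_ne_zero hB
  refine ⟨hμB, ?_⟩
  have h : (lam Θ : ℕ∞) = ((lam B + (cyclotomicOmegaMinus p n).natDegree : ℕ) : ℕ∞) := by
    rw [hlamΘ, hord, hUord, ← hlamB, Nat.cast_add, add_comm]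
  exact (Nat.cast_injective (R := ℕ∞) h).symm

end Reading

end Summit.BirchSwinnertonDyer.Rank1Residual.Supersingular

end
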